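import Mathlib
import Literature.MathematicalPhysics.QuantumFieldTheory.Dimock2011to13.FluctuationCovarianceIdentity

/-!
# Dimock, *The renormalization group according to Balaban* II (large fields), §3.8–§3.9: the boundary determinant
# term `R^{(6)}` — the regrouping (stay2) → (stay3), the `ℓ²` bound of the weights `‖A_{k,r}δ_y‖₂ ≤ O(1)(1+r)^{−1}`,
# LEMMA `r6` (`|R^{(6)}(□)| ≤ C(LM)³`) as a mechanism, and «b′_k is bounded» — PROVED

**Citation header (reproduction of PUBLISHED work; template of the Bałaban lattice Yang–Mills cell).**
J. Dimock, *The renormalization group according to Balaban II. Large fields*, J. Math. Phys. **54** (2013) 092301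
(= arXiv:1212.5562v2) [Dimock2013BalabanII], §3.8 (stay1) L3221–3227, (z5) L3228–3236, (stay2)–(stay3) and `b_k`, `b′_k`
TeX L3237–3273, and §3.9 Lemma 3.8 `\label{r6}` L3549–3595.  TeX line numbers refer to the arXiv source held by the cell
on this hub at `run/shared/lean/archive/nearmiss/qft-balaban/dimock/src/1212.5562/1212.5562.tex` (7217 lines, sha256[:16]
75c5792fc48eacbc); every quotation below was read there (v1: gen 34; re-read for v1.1, gen 35).  Dimock's papers are
published and refereed and are the cell's TEMPLATE, not manuscripts under audit; no quantity of the Bałaban series is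
touched.

**What the paper prints (verbatim; `…` marks an elision).**  L3237–3246: *"Thus the exponent in (stay1) can be written
½ log a_k tr[I − QᵀQ]_{Ω^c_{k+1}} + ½ log(a_k + aL^{−2}) tr[QᵀQ]_{Ω^c_{k+1}} − ½a_k²∫₀^∞ tr[A_{k,r}Q_kG_{k,Ω′,r}Q_kᵀ
A_{k,r}]_{Ω_{k+1}}dr + ½a_k²∫₀^∞ tr[A_{k,r}Q_kG_{k,r}Q_kᵀA_{k,r}]dr  (stay2)"*.  L3259–3268: *"The second two terms in
(stay2) can be written −½a_k²∫₀^∞(tr[A_{k,r}Q_k(G_{k,Ω′,r} − G_{k,r})Q_kᵀA_{k,r}]_{Ω_{k+1}} − tr[A_{k,r}Q_kG_{k,r}Q_kᵀ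
A_{k,r}]_{Ω^c_{k+1}})dr  (stay3)  The first term here is defined to be R^{(6)}_{𝚷,Ω_{k+1}} and the second term is
½a_k²b′_k|Ω^{c,(k)}_{k+1}| where b′_k = ∫(A_{k,r}Q_kG_{k,r}Q_kᵀA_{k,r})(x,x)dr is independent of x. We will see that b_k′
is bounded in k."*  L3595: *"Similar estimates show that b_k′ is bounded."*  Lemma `r6`, L3549–3562: *"R^{(6)}_{𝚷,Ω_{k+1}}
has a local expansion in LM cubes  R^{(6)}_{𝚷,Ω_{k+1}} = Σ_{□⊂Ω_{k+1}} R^{(6)}_{k,𝚷,Ω_{k+1}}(□)   |R^{(6)}_{𝚷,Ω_{k+1}}(□)| ≤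
C(LM)³  If □ ⊂ Ω_{k+1} − Ω^♮_{k+1} then the bound improves to |R^{(6)}_{𝚷,Ω_{k+1}}(□)| ≤ C(LM)³e^{−r_{k+1}}
(improved)"*; its proof, L3566–3581: *"R^{(6)}_{𝚷,Ω_{k+1}} is given in (stay3). With D_{k,Ω′,r} = [Q_kG_{k,Ω′,r}Q_kᵀ]_{Ω_{k+1}}
and D_{k,r} = [Q_kG_{k,r}Q_kᵀ]_{Ω_{k+1}} the expansion holds with R^{(6)}_{𝚷,Ω_{k+1}}(□) = −½a_k²∫₀^∞ Σ_{y∈□}(A_{k,r}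
(D_{k,Ω′,r} − D_{k,r})A_{k,r})(y,y)dr  Since ‖A_{k,r}δ_y‖₂ ≤ O(1)(1+r)^{−1} and |D_{k,Ω′,r}(y,y′) − D_{k,r}(y,y′)| ≤
Ce^{−γd(y,y′)} we have |⟨A_{k,r}δ_y, (D_{k,Ω′,r} − D_{k,r})A_{k,r}δ_y⟩| ≤ C‖A_{k,r}δ_y‖²₂ ≤ C(1+r)^{−2}  This gives the
announced R^{(6)}_{𝚷,Ω_{k+1}}(□) ≤ C(LM)³∫₀^∞(1+r)^{−2} ≤ C(LM)³"*.

**Sign record (v1.1; INFO-1 of the cross-read at journal l.9287, confirmed from the TeX; records only, nothing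
adjudicated).**  (stay1) L3221–3226 has the exponent `−½ tr log([Δ_{k,Ω(Λ*_k)} + aL^{−2}QᵀQ]_{Ω_{k+1}}) + ½ tr log(Δ_k +
aL^{−2}QᵀQ)`, and (z5) L3229–3234 gives `log[…]_{Ω_{k+1}} = log a_k[I − QᵀQ]_{Ω_{k+1}} + log(a_k + aL^{−2})[QᵀQ]_{Ω_{k+1}} −
a_k²∫₀^∞[A_{k,r}Q_kG_{k,Ω′,r}Q_kᵀA_{k,r}]_{Ω_{k+1}}dr` (the integral with the sign `−`, as in the kernel theorems
`RegionalLogDeterminant.log_det_ckOrInv_eq`∕`log_det_ckInv_eq`); inserting (z5) and its global analogue into (stay1)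
yields the two trace terms over `Ω^c_{k+1}` exactly as (stay2) prints them and the integral pair with the signs
`+½a_k²∫tr[…G_{k,Ω′,r}…]_{Ω_{k+1}}dr − ½a_k²∫tr[…G_{k,r}…]dr` — the signs carried by the sibling kernel theorem
`RegionalLogDeterminant.det_sqrt_regional_eq` — whereas (stay2) L3242–3244 prints this pair as `(−, +)`; (stay3), the
sign in the definition of `R^{(6)}` (L3266, L3568–3570) and `b″_k = b_k + a_k²b′_k` (L3273) follow (stay2)'s convention.
Downstream the paper uses only `|R^{(6)}(□)|` bounds (Lemma `r6`) and «b′_k is bounded», so nothing of substance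
depends on the convention; in this module `regroup_stay3` is the printed regrouping as an IDENTITY (valid as printed),
`regroup_stay3_neg` (v1.1) is the same identity with both sides negated (the (stay1)+(z5) signs), and every bound is
on an absolute value.

**What is reproduced here (kernel-checked, zero `sorry`; imports Mathlib + sibling `FluctuationCovarianceIdentity` for
`proj Q = QᵀQ` and `Akr Q a_k aL r = (a_k+r)⁻¹(I − QᵀQ) + (a_k+aL+r)⁻¹QᵀQ`, print `aL` = aL^{−2}).**
* §1 **`dot_Akr_mulVec_le` (hQ : QQᵀ = I) (hak : 0 < a_k) (haL : 0 ≤ aL) (hr : 0 ≤ r) : ⟨A_{k,r}v, A_{k,r}v⟩ ≤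
  (a_k+r)⁻²⟨v,v⟩** (QᵀQ is an orthogonal projection; the print's «‖A_{k,r}δ_y‖₂ ≤ O(1)(1+r)^{−1}», sharp constant),
  `dot_Akr_mulVec_single_le` (for `δ_y`), `Akr_mulVec_eq`, `Akr_transpose`.
* §2 **`abs_diag_le`**: for any `E` with `|⟨u,Eu⟩| ≤ K⟨u,u⟩`, `|(A_{k,r}EA_{k,r})(y,y)| ≤ K(a_k+r)⁻²` (the print's display
  with `E = D_{k,Ω′,r} − D_{k,r}`, `K = C` from the kernel decay); **`abs_sum_diag_le`**: `|Σ_{y∈□}(…)(y,y)| ≤ #□·K·(a_k+r)⁻²`.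
* §3 private `integral_Ioi_inv_add_sq` (`∫₀^∞(a+r)⁻²dr = a⁻¹`, integrably); **`abs_R6loc_le`**: for any family `E(r)`
  with the form bound for `r > 0`: **`|−½a_k²∫₀^∞ Σ_{y∈□}(A_{k,r}E(r)A_{k,r})(y,y)dr| ≤ ½a_kK·#□`** (= Lemma `r6`'s
  `C(LM)³` with `#□ = (LM)³`; with `K ↦ Ke^{−r_{k+1}}` the improvement (improved)); **`abs_bprime_le`**:
  `|∫₀^∞(A_{k,r}D(r)A_{k,r})(x,x)dr| ≤ K/a_k` («b′_k is bounded»).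
* §4 **`regroup_stay3`**: the finite regrouping behind (stay2) → (stay3) at fixed `r`:
  `−½a²Σ_{Ω}X′(y,y) + ½a² tr X = −½a²(Σ_{Ω}(X′ − X)(y,y) − Σ_{Ω^c}X(y,y))`; `regroup_stay3_neg` (v1.1): the same with
  the integral signs of (stay1)+(z5), `½a²Σ_{Ω}X′(y,y) − ½a² tr X = ½a²(Σ_{Ω}(X′ − X)(y,y) − Σ_{Ω^c}X(y,y))`.
* §5 a non-vacuity `example`.

**Readings (declared).**  (i) `D_{k,Ω′,r}`, `D_{k,r}` enter as ABSTRACT matrices (families in `r`) with a quadratic-form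
bound `|⟨u,Eu⟩| ≤ K⟨u,u⟩` — the print derives this from the kernel decay `|D_{k,Ω′,r}(y,y′) − D_{k,r}(y,y′)| ≤
Ce^{−γd(y,y′)}` (random-walk input, Lemma 3.4∕App. C, not reproduced); the regional objects are read on the index set of
the unit lattice (the print's `[…]_{Ω_{k+1}}`).  (ii) The improper `dr`-integrals are Lebesgue integrals over `(0,∞)`;
`abs_R6loc_le` needs no integrability hypothesis (a non-integrable integrand has integral `0` in Mathlib and the bound
holds trivially) — the print's integrand is continuous and dominated, which is not restated.  (iii) `(1+r)^{−1}` of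
the print (with `a_k` bounded above and below) is the sharp `(a_k+r)⁻¹` here.

**What is NOT claimed.**  The random-walk expansions and locality of `G_{k,Ω′,r}`, `G_{k,r}` (weakened unit-lattice
condition), the kernel decay bound and its `e^{−r_{k+1}}` improvement, analyticity in the complex domain `R_{k,𝚷}`, the
statement that `(A_{k,r}Q_kG_{k,r}Q_kᵀA_{k,r})(x,x)` is independent of `x`, `|Ω^{(k)}_{k+1}| = Vol(Ω_{k+1})`, `b″_k`,
`c_{k+1}`, (sugar); (stay1)∕(z5) themselves are the sibling `RegionalLogDeterminant` (v8.81), `R^{(5)}`∕Lemma `r5` the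
sibling `LocalSquareRootDeterminant` (v8.80); anything of B1–B16 (TEMPLATE.md §4.2 row «D2 §3.8 fluctuation integral …»
B-side loci untouched).  NOT summit progress; NOT a statement about any Bałaban paper; NOT continuum; NOT Clay.  Imports
Mathlib + `Dimock2011to13.FluctuationCovarianceIdentity`; no Summits import; sub-namespace
`…Dimock2011to13.BoundaryDeterminantTerm`; modifies nothing.  Unit `b2b-balaban-template` gen 34 (journal CLAIM
D2-R6-KERNEL); v1.1 gen 35 (journal CLAIM D2-R6-DOCFIX: header quotations restored verbatim and locators corrected per
the cross-read of journal l.9287, sign record added, `regroup_stay3_neg` added; v1 statements and proofs unchanged);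
cell records TEMPLATE.md §4.2 row «D2 §3.8», GAPS C-tmpl34-4, C-tmpl35-4.
-/

noncomputable section

open scoped BigOperators Matrix
open Finset MeasureTheory Set Filter Topology Matrix

namespace Literature.MathematicalPhysics.QuantumFieldTheory.Dimock2011to13.BoundaryDeterminantTerm

open FluctuationCovarianceIdentity

/-! ## §1 The `ℓ²` bound of the weights: `‖A_{k,r}v‖₂ ≤ (a_k + r)⁻¹‖v‖₂` -/

section Weights

variable {ι σ : Type*} [Fintype ι] [Fintype σ] [DecidableEq ι] [DecidableEq σ] {Q : Matrix σ ι ℝ} {ak aL r : ℝ}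

omit [Fintype σ] [DecidableEq ι] [DecidableEq σ] in
/-- `v ⬝ (A w) = (Aᵀ v) ⬝ w`. [folklore] -/
private theorem dot_mulVec_eq_transpose_mulVec_dot (v w : ι → ℝ) (A : Matrix ι ι ℝ) :
    v ⬝ᵥ (A *ᵥ w) = (Aᵀ *ᵥ v) ⬝ᵥ w := by
  rw [Matrix.dotProduct_mulVec, Matrix.mulVec_transpose]

omit [Fintype σ] [DecidableEq ι] [DecidableEq σ] in
/-- `v ⬝ v ≥ 0` over `ℝ`. [folklore] -/
private theorem dot_self_nonneg (v : ι → ℝ) : 0 ≤ v ⬝ᵥ v :=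
  Finset.sum_nonneg fun i _ => mul_self_nonneg (v i)

omit [Fintype ι] [DecidableEq ι] [DecidableEq σ] in
/-- `P = QᵀQ` is symmetric. [folklore] -/
private theorem proj_transpose (Q : Matrix σ ι ℝ) : (proj Q)ᵀ = proj Q := by
  unfold proj; rw [transpose_mul, transpose_transpose]

omit [DecidableEq ι] in
/-- `QQᵀ = I ⇒ P² = P`. [folklore] -/
private theorem proj_mul_proj (hQ : Q * Qᵀ = 1) : proj Q * proj Q = proj Q := by
  unfold proj; rw [Matrix.mul_assoc, ← Matrix.mul_assoc Q, hQ, Matrix.one_mul]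

omit [DecidableEq ι] in
/-- `⟨Pv, Pv⟩ = ⟨v, Pv⟩`. [folklore] -/
private theorem proj_dot_proj (hQ : Q * Qᵀ = 1) (v : ι → ℝ) :
    (proj Q *ᵥ v) ⬝ᵥ (proj Q *ᵥ v) = v ⬝ᵥ (proj Q *ᵥ v) := by
  rw [dot_mulVec_eq_transpose_mulVec_dot, proj_transpose, mulVec_mulVec, proj_mul_proj hQ, dotProduct_comm]

omit [DecidableEq σ] in
/-- `A_{k,r}v = (a_k + r)⁻¹(v − Pv) + (a_k + aL⁻² + r)⁻¹ Pv`. [cite: Dimock2013BalabanII, §3.8 eq. (z3) (arXiv:1212.5562v2 TeX L3144–3146)] -/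
theorem Akr_mulVec_eq (v : ι → ℝ) :
    Akr Q ak aL r *ᵥ v = (ak + r)⁻¹ • (v - proj Q *ᵥ v) + (ak + aL + r)⁻¹ • (proj Q *ᵥ v) := by
  unfold Akr
  rw [add_mulVec, smul_mulVec, smul_mulVec, sub_mulVec, one_mulVec]

omit [Fintype ι] [DecidableEq σ] in
/-- `A_{k,r}` is symmetric. [cite: Dimock2013BalabanII, §3.8 eq. (z3) (arXiv:1212.5562v2 TeX L3144–3146)] -/
theorem Akr_transpose (Q : Matrix σ ι ℝ) (ak aL r : ℝ) : (Akr Q ak aL r)ᵀ = Akr Q ak aL r := by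
  unfold Akr
  rw [transpose_add, transpose_smul, transpose_smul, transpose_sub, transpose_one, proj_transpose]

/-- **`‖A_{k,r}v‖₂² ≤ (a_k + r)⁻²‖v‖₂²`** — *"Since ‖A_{k,r}δ_y‖₂ ≤ O(1)(1 + r)^{−1}"*: `P = QᵀQ` is an orthogonal projection
(`QQᵀ = I`), so `‖A_{k,r}v‖² = (a_k+r)⁻²‖(1−P)v‖² + (a_k+aL⁻²+r)⁻²‖Pv‖² ≤ (a_k+r)⁻²‖v‖²` (`a_k > 0`, `aL⁻² ≥ 0`, `r ≥ 0`).
[cite: Dimock2013BalabanII, Lemma r6 proof (arXiv:1212.5562v2 TeX L3572–3577)] -/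
theorem dot_Akr_mulVec_le (hQ : Q * Qᵀ = 1) (hak : 0 < ak) (haL : 0 ≤ aL) (hr : 0 ≤ r) (v : ι → ℝ) :
    (Akr Q ak aL r *ᵥ v) ⬝ᵥ (Akr Q ak aL r *ᵥ v) ≤ ((ak + r)⁻¹) ^ 2 * (v ⬝ᵥ v) := by
  set u := proj Q *ᵥ v with hu
  set w := v - u with hw
  have huu : u ⬝ᵥ u = v ⬝ᵥ u := proj_dot_proj hQ v
  have hwu : w ⬝ᵥ u = 0 := by rw [hw, sub_dotProduct, huu, sub_self]
  have hvv : v ⬝ᵥ v = w ⬝ᵥ w + u ⬝ᵥ u := by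
    have hv : v = w + u := by rw [hw, sub_add_cancel]
    conv_lhs => rw [hv]
    rw [add_dotProduct, dotProduct_add, dotProduct_add, dotProduct_comm u w, hwu]
    ring
  rw [Akr_mulVec_eq, ← hu, ← hw]
  have hexp : ((ak + r)⁻¹ • w + (ak + aL + r)⁻¹ • u) ⬝ᵥ ((ak + r)⁻¹ • w + (ak + aL + r)⁻¹ • u)
      = ((ak + r)⁻¹) ^ 2 * (w ⬝ᵥ w) + ((ak + aL + r)⁻¹) ^ 2 * (u ⬝ᵥ u) := by
    simp only [add_dotProduct, dotProduct_add, smul_dotProduct, dotProduct_smul, smul_eq_mul, dotProduct_comm u w, hwu]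
    ring
  rw [hexp, hvv]
  have h1 : 0 < ak + r := by linarith
  have hβα : (ak + aL + r)⁻¹ ≤ (ak + r)⁻¹ := inv_anti₀ h1 (by linarith)
  have hβ0 : 0 ≤ (ak + aL + r)⁻¹ := inv_nonneg.2 (by linarith)
  have hsq : ((ak + aL + r)⁻¹) ^ 2 ≤ ((ak + r)⁻¹) ^ 2 := pow_le_pow_left₀ hβ0 hβα 2
  have hww := dot_self_nonneg w
  have huu0 := dot_self_nonneg u
  nlinarith

/-- For the unit vector `δ_y`: **`‖A_{k,r}δ_y‖₂² ≤ (a_k + r)⁻²`** (*"‖A_{k,r}δ_y‖₂ ≤ O(1)(1+r)^{−1}"*).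
[cite: Dimock2013BalabanII, Lemma r6 proof (arXiv:1212.5562v2 TeX L3572–3577)] -/
theorem dot_Akr_mulVec_single_le (hQ : Q * Qᵀ = 1) (hak : 0 < ak) (haL : 0 ≤ aL) (hr : 0 ≤ r) (y : ι) :
    (Akr Q ak aL r *ᵥ Pi.single y 1) ⬝ᵥ (Akr Q ak aL r *ᵥ Pi.single y 1) ≤ ((ak + r)⁻¹) ^ 2 := by
  have h := dot_Akr_mulVec_le hQ hak haL hr (Pi.single y (1 : ℝ))
  rwa [single_dotProduct, Pi.single_eq_same, one_mul, mul_one] at h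

end Weights

/-! ## §2 The diagonal entries `(A_{k,r}(D′ − D)A_{k,r})(y,y)` and the block term of `R^{(6)}` -/

section BlockTerm

variable {ι σ : Type*} [Fintype ι] [Fintype σ] [DecidableEq ι] [DecidableEq σ] {Q : Matrix σ ι ℝ} {ak aL r : ℝ}

omit [Fintype σ] [DecidableEq σ] in
/-- The diagonal entry as a quadratic form: `(AEA)(y,y) = ⟨Aδ_y, E Aδ_y⟩` for symmetric `A` (print:
*"⟨A_{k,r}δ_y, (D_{k,Ω′,r} − D_{k,r})A_{k,r}δ_y⟩"*). [folklore] -/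
private theorem diag_eq_form {A E : Matrix ι ι ℝ} (hA : Aᵀ = A) (y : ι) :
    (A * E * A) y y = (A *ᵥ Pi.single y 1) ⬝ᵥ (E *ᵥ (A *ᵥ Pi.single y 1)) := by
  calc (A * E * A) y y = ((A * E * A) *ᵥ Pi.single y 1) y := by rw [Matrix.mulVec_single_one]; rfl
    _ = Pi.single y (1 : ℝ) ⬝ᵥ ((A * E * A) *ᵥ Pi.single y 1) := by rw [single_dotProduct, one_mul]
    _ = Pi.single y (1 : ℝ) ⬝ᵥ (A *ᵥ (E *ᵥ (A *ᵥ Pi.single y 1))) := by rw [mulVec_mulVec, mulVec_mulVec]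
    _ = _ := by rw [dot_mulVec_eq_transpose_mulVec_dot, hA]

/-- **The one-site estimate of Lemma `r6`**: for a symmetric `E` (print: `D_{k,Ω′,r} − D_{k,r}`) with the quadratic-form
bound `|⟨u, Eu⟩| ≤ K‖u‖₂²` (print: from *"|D_{k,Ω′,r}(y,y′) − D_{k,r}(y,y′)| ≤ Ce^{−γd(y,y′)}"*):
`|(A_{k,r}EA_{k,r})(y,y)| = |⟨A_{k,r}δ_y, EA_{k,r}δ_y⟩| ≤ K‖A_{k,r}δ_y‖₂² ≤ K(a_k + r)⁻²` — *"≤ C‖A_{k,r}δ_y‖²₂ ≤ C(1+r)^{−2}"*.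
[cite: Dimock2013BalabanII, Lemma r6 proof (arXiv:1212.5562v2 TeX L3572–3577)] -/
theorem abs_diag_le (hQ : Q * Qᵀ = 1) (hak : 0 < ak) (haL : 0 ≤ aL) (hr : 0 ≤ r) {E : Matrix ι ι ℝ} {K : ℝ}
    (hK0 : 0 ≤ K) (hK : ∀ u : ι → ℝ, |u ⬝ᵥ (E *ᵥ u)| ≤ K * (u ⬝ᵥ u)) (y : ι) :
    |(Akr Q ak aL r * E * Akr Q ak aL r) y y| ≤ K * ((ak + r)⁻¹) ^ 2 := by
  rw [diag_eq_form (Akr_transpose Q ak aL r)]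
  exact (hK _).trans (mul_le_mul_of_nonneg_left (dot_Akr_mulVec_single_le hQ hak haL hr y) hK0)

/-- **The block term**: `|Σ_{y∈□}(A_{k,r}EA_{k,r})(y,y)| ≤ #□·K·(a_k + r)⁻²` (*"This gives the announced R^{(6)}(□) ≤
C(LM)³∫₀^∞(1+r)^{−2}"*, `#□ = (LM)³`). [cite: Dimock2013BalabanII, Lemma r6 proof (arXiv:1212.5562v2 TeX L3566–3581)] -/
theorem abs_sum_diag_le (hQ : Q * Qᵀ = 1) (hak : 0 < ak) (haL : 0 ≤ aL) (hr : 0 ≤ r) {E : Matrix ι ι ℝ} {K : ℝ}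
    (hK0 : 0 ≤ K) (hK : ∀ u : ι → ℝ, |u ⬝ᵥ (E *ᵥ u)| ≤ K * (u ⬝ᵥ u)) (blk : Finset ι) :
    |∑ y ∈ blk, (Akr Q ak aL r * E * Akr Q ak aL r) y y| ≤ blk.card * (K * ((ak + r)⁻¹) ^ 2) := by
  refine (abs_sum_le_sum_abs _ _).trans ?_
  calc ∑ y ∈ blk, |(Akr Q ak aL r * E * Akr Q ak aL r) y y| ≤ ∑ _y ∈ blk, K * ((ak + r)⁻¹) ^ 2 :=
        sum_le_sum fun y _ => abs_diag_le hQ hak haL hr hK0 hK y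
    _ = blk.card * (K * ((ak + r)⁻¹) ^ 2) := by rw [sum_const, nsmul_eq_mul]

end BlockTerm

/-! ## §3 `∫₀^∞ (a_k + r)⁻² dr = a_k⁻¹` and the bounds of Lemma `r6` and of `b′_k` -/

section Integral

/-- `∫₀^∞ (a + r)⁻² dr = a⁻¹` for `a > 0`, integrably (the print's *"∫₀^∞ (1+r)^{−2}"*). [folklore] -/
private theorem integral_Ioi_inv_add_sq {a : ℝ} (ha : 0 < a) :
    IntegrableOn (fun r : ℝ => ((a + r)⁻¹) ^ 2) (Ioi 0) ∧ ∫ r in Ioi (0 : ℝ), ((a + r)⁻¹) ^ 2 = a⁻¹ := by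
  set F : ℝ → ℝ := fun r => -(a + r)⁻¹ with hF
  have hderiv : ∀ r ∈ Ici (0 : ℝ), HasDerivAt F (((a + r)⁻¹) ^ 2) r := by
    intro r hr
    have h0 : a + r ≠ 0 := by have := mem_Ici.1 hr; positivity
    have h1 : HasDerivAt (fun x : ℝ => a + x) 1 r := by simpa using (hasDerivAt_id r).const_add a
    have h2 := (h1.inv h0).neg
    have hval : -(-(1 : ℝ) / (a + r) ^ 2) = ((a + r)⁻¹) ^ 2 := by rw [neg_div, neg_neg, inv_pow, one_div]
    rw [hval] at h2
    exact h2
  have hlim : Tendsto F atTop (𝓝 0) := by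
    have h : Tendsto (fun r : ℝ => (a + r)⁻¹) atTop (𝓝 0) :=
      tendsto_inv_atTop_zero.comp (tendsto_atTop_add_const_left atTop a tendsto_id)
    simpa [hF] using h.neg
  have hint : IntegrableOn (fun r : ℝ => ((a + r)⁻¹) ^ 2) (Ioi 0) :=
    integrableOn_Ioi_deriv_of_nonneg' hderiv (fun r _ => sq_nonneg _) hlim
  refine ⟨hint, ?_⟩
  rw [integral_Ioi_of_hasDerivAt_of_tendsto' hderiv hint hlim]
  simp [hF]

variable {ι σ : Type*} [Fintype ι] [Fintype σ] [DecidableEq ι] [DecidableEq σ] {Q : Matrix σ ι ℝ} {ak aL : ℝ}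

/-- **LEMMA `r6` (the local expansion of `R^{(6)}` and its bound)** — *"R^{(6)}(□) = −½a_k²∫₀^∞ Σ_{y∈□}(A_{k,r}(D_{k,Ω′,r} −
D_{k,r})A_{k,r})(y,y)dr … |⟨A_{k,r}δ_y, (D_{k,Ω′,r} − D_{k,r})A_{k,r}δ_y⟩| ≤ C‖A_{k,r}δ_y‖²₂ ≤ C(1+r)^{−2}. This gives the
announced R^{(6)}(□) ≤ C(LM)³∫₀^∞(1+r)^{−2} ≤ C(LM)³"*: for any family `E(r)` (print: `D_{k,Ω′,r} − D_{k,r}`) with the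
quadratic-form bound `|⟨u,E(r)u⟩| ≤ K‖u‖₂²` for `r > 0`, `QQᵀ = I`, `a_k > 0`, `aL⁻² ≥ 0`:
`|−½a_k²∫₀^∞ Σ_{y∈□}(A_{k,r}E(r)A_{k,r})(y,y)dr| ≤ ½a_kK·#□` (with `∫₀^∞(a_k+r)⁻²dr = a_k⁻¹`; if the integrand is not
integrable the Lebesgue integral is `0` and the bound holds trivially). With `K ↦ Ke^{−r_{k+1}}` this is the improved
bound (improved) for `□ ⊂ Ω_{k+1} − Ω^♮_{k+1}`. [cite: Dimock2013BalabanII, Lemma r6 (arXiv:1212.5562v2 TeX L3549–3591)] -/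
theorem abs_R6loc_le (hQ : Q * Qᵀ = 1) (hak : 0 < ak) (haL : 0 ≤ aL) {E : ℝ → Matrix ι ι ℝ} {K : ℝ} (hK0 : 0 ≤ K)
    (hK : ∀ r : ℝ, 0 < r → ∀ u : ι → ℝ, |u ⬝ᵥ (E r *ᵥ u)| ≤ K * (u ⬝ᵥ u)) (blk : Finset ι) :
    |(-(1 / 2) * ak ^ 2) * ∫ r in Ioi (0 : ℝ), ∑ y ∈ blk, (Akr Q ak aL r * E r * Akr Q ak aL r) y y|
      ≤ (1 / 2) * ak * K * blk.card := by
  have hI := integral_Ioi_inv_add_sq hak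
  have hg : Integrable (fun r : ℝ => (blk.card : ℝ) * (K * ((ak + r)⁻¹) ^ 2)) (volume.restrict (Ioi 0)) :=
    (hI.1.const_mul K).const_mul (blk.card : ℝ)
  have hbound : ‖∫ r in Ioi (0 : ℝ), ∑ y ∈ blk, (Akr Q ak aL r * E r * Akr Q ak aL r) y y‖
      ≤ ∫ r in Ioi (0 : ℝ), (blk.card : ℝ) * (K * ((ak + r)⁻¹) ^ 2) := by
    refine norm_integral_le_of_norm_le hg ?_
    refine (ae_restrict_iff' measurableSet_Ioi).2 (ae_of_all _ fun r hr => ?_)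
    rw [Real.norm_eq_abs]
    exact abs_sum_diag_le hQ hak haL (le_of_lt hr) hK0 (hK r hr) blk
  have hval : ∫ r in Ioi (0 : ℝ), (blk.card : ℝ) * (K * ((ak + r)⁻¹) ^ 2) = blk.card * (K * ak⁻¹) := by
    rw [integral_const_mul, integral_const_mul, hI.2]
  rw [hval, Real.norm_eq_abs] at hbound
  rw [abs_mul, show |(-(1 / 2) * ak ^ 2 : ℝ)| = (1 / 2) * ak ^ 2 by
    rw [abs_of_nonpos (by nlinarith [sq_nonneg ak])]; ring]
  calc (1 / 2) * ak ^ 2 * |∫ r in Ioi (0 : ℝ), ∑ y ∈ blk, (Akr Q ak aL r * E r * Akr Q ak aL r) y y|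
      ≤ (1 / 2) * ak ^ 2 * (blk.card * (K * ak⁻¹)) := by gcongr
    _ = (1 / 2) * ak * K * blk.card := by field_simp

/-- **`b′_k` is bounded** — *"b′_k = ∫(A_{k,r}Q_kG_{k,r}Q_kᵀA_{k,r})(x,x)dr … Similar estimates show that b′_k is bounded"*:
with `D(r) = Q_kG_{k,r}Q_kᵀ` satisfying `|⟨u,D(r)u⟩| ≤ K‖u‖₂²` for `r > 0`: `|∫₀^∞(A_{k,r}D(r)A_{k,r})(x,x)dr| ≤ K/a_k`.
[cite: Dimock2013BalabanII, §3.8 (after (stay3)) and Lemma r6 proof (arXiv:1212.5562v2 TeX L3266–3268, L3595)] -/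
theorem abs_bprime_le (hQ : Q * Qᵀ = 1) (hak : 0 < ak) (haL : 0 ≤ aL) {D : ℝ → Matrix ι ι ℝ} {K : ℝ} (hK0 : 0 ≤ K)
    (hK : ∀ r : ℝ, 0 < r → ∀ u : ι → ℝ, |u ⬝ᵥ (D r *ᵥ u)| ≤ K * (u ⬝ᵥ u)) (x : ι) :
    |∫ r in Ioi (0 : ℝ), (Akr Q ak aL r * D r * Akr Q ak aL r) x x| ≤ K * ak⁻¹ := by
  have hI := integral_Ioi_inv_add_sq hak
  have hg : Integrable (fun r : ℝ => K * ((ak + r)⁻¹) ^ 2) (volume.restrict (Ioi 0)) := hI.1.const_mul K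
  have hbound : ‖∫ r in Ioi (0 : ℝ), (Akr Q ak aL r * D r * Akr Q ak aL r) x x‖
      ≤ ∫ r in Ioi (0 : ℝ), K * ((ak + r)⁻¹) ^ 2 := by
    refine norm_integral_le_of_norm_le hg ?_
    refine (ae_restrict_iff' measurableSet_Ioi).2 (ae_of_all _ fun r hr => ?_)
    rw [Real.norm_eq_abs]
    exact abs_diag_le hQ hak haL (le_of_lt hr) hK0 (hK r hr) x
  rwa [integral_const_mul, hI.2, Real.norm_eq_abs] at hbound

end Integral

/-! ## §4 The regrouping (stay2) → (stay3): traces over `Ω_{k+1}` and over its complement -/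

section Regroup

variable {ι : Type*} [Fintype ι] [DecidableEq ι]

/-- `tr X = Σ_{y∈Ω} X(y,y) + Σ_{y∈Ω^c} X(y,y)` (the trace over the whole unit lattice splits over `Ω_{k+1}` and
`Ω^c_{k+1}`). [folklore] -/
private theorem trace_eq_sum_add_sum_compl (X : Matrix ι ι ℝ) (Ω : Finset ι) :
    trace X = ∑ y ∈ Ω, X y y + ∑ y ∈ Ωᶜ, X y y := by
  rw [Matrix.trace, sum_add_sum_compl]
  rfl

/-- **(stay3)**: *"The second two terms in (stay2) can be written −½a_k²∫₀^∞(tr[A_{k,r}Q_k(G_{k,Ω′,r} − G_{k,r})Q_kᵀ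
A_{k,r}]_{Ω_{k+1}} − tr[A_{k,r}Q_kG_{k,r}Q_kᵀA_{k,r}]_{Ω^c_{k+1}})dr"* — the finite regrouping at fixed `r`: for the
regional integrand `X′ = A(D′)A` (zero use outside `Ω_{k+1}`) and the global `X = ADA` on the unit lattice,
`−½a²(Σ_{Ω}X′(y,y)) + ½a² tr X = −½a²(Σ_{Ω}(X′ − X)(y,y) − Σ_{Ω^c}X(y,y))`; the first piece is `R^{(6)}`'s integrand,
the second `½a_k²b′_k|Ω^c|`'s. [cite: Dimock2013BalabanII, §3.8 eqs. (stay2)–(stay3) (arXiv:1212.5562v2 TeX L3237–3268)] -/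
theorem regroup_stay3 (a : ℝ) (X' X : Matrix ι ι ℝ) (Ω : Finset ι) :
    -(1 / 2) * a ^ 2 * (∑ y ∈ Ω, X' y y) + (1 / 2) * a ^ 2 * trace X
      = -(1 / 2) * a ^ 2 * ((∑ y ∈ Ω, (X' - X) y y) - ∑ y ∈ Ωᶜ, X y y) := by
  rw [trace_eq_sum_add_sum_compl X Ω]
  simp only [Matrix.sub_apply, sum_sub_distrib]
  ring

/-- the same regrouping with the integral signs that (stay1) L3221–3226 and (z5) L3229–3234 produce (`+` regional,
`−` global; the signs of the sibling `RegionalLogDeterminant.det_sqrt_regional_eq` — see the header's sign record):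
`½a²(Σ_{Ω}X′(y,y)) − ½a² tr X = ½a²(Σ_{Ω}(X′ − X)(y,y) − Σ_{Ω^c}X(y,y))`. [cite: Dimock2013BalabanII, §3.8 eqs. (stay1), (z5), (stay3) (arXiv:1212.5562v2 TeX L3221–3236, L3259–3268)] -/
theorem regroup_stay3_neg (a : ℝ) (X' X : Matrix ι ι ℝ) (Ω : Finset ι) :
    (1 / 2) * a ^ 2 * (∑ y ∈ Ω, X' y y) - (1 / 2) * a ^ 2 * trace X
      = (1 / 2) * a ^ 2 * ((∑ y ∈ Ω, (X' - X) y y) - ∑ y ∈ Ωᶜ, X y y) := by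
  have h := regroup_stay3 a X' X Ω
  linarith

end Regroup

/-! ## §5 Non-vacuity -/

/-- The hypotheses of `abs_R6loc_le` are met, e.g. by `E ≡ 0`, `K = 0` (one site, `Q = 1`). -/
example : |(-(1 / 2) * (1 : ℝ) ^ 2) * ∫ r in Ioi (0 : ℝ), ∑ y ∈ (univ : Finset (Fin 1)),
      (Akr (1 : Matrix (Fin 1) (Fin 1) ℝ) 1 0 r * (0 : Matrix (Fin 1) (Fin 1) ℝ) * Akr (1 : Matrix (Fin 1) (Fin 1) ℝ) 1 0 r) y y|
    ≤ (1 / 2) * 1 * 0 * ((univ : Finset (Fin 1)).card : ℝ) :=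
  abs_R6loc_le (E := fun _ => 0) (by simp) one_pos le_rfl le_rfl (fun r _ u => by simp) univ

end Literature.MathematicalPhysics.QuantumFieldTheory.Dimock2011to13.BoundaryDeterminantTerm

end
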